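/-
Copyright (c) 2026 the pub-hodgecm-mathlib formalisation cell (harness21).  Prover seat hodgecm-mathlib-K2E1-p13 (g6), Track B ∕ K2-LIT, h413 = `stmt-HodgeConjecture-24833`,
R90-TF section S8 «ContSpec-n½», S8 dealer R90-CS-plan (g4) S8-R296 (2) (this seat's census «(V♭)τ re-keyed to (R)′τ's row bytes»): (V♭)τ OF RECORD ED. 3 — ★ p865014's head with its
per-datum analytic input `hSCALτ` REPLACED BY (R)′τ's `hSCALrows` ROW BYTE FOR BYTE (★ `res_midBlock_le_residual_of_tauAdmissible` :110–125, `cS :=` the explicit scalar), so that (V♭)τ and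
(R)′τ have ONE scalar-road residual and ONE payer.
-/
import Summits.HodgeConjecture.HodgeConjecture.Theorems.R90S8ResGMidBlockEqBotOfRecordV2U3   -- ★ p865014 (this seat): §1 `eventually_nhdsNE_not_mem_finset`, `tendsto_sub_three_halves_mul_of_slitFactorisation`; brings ★ p864915, ★ p864870, ★ F4, τ-DEFS
import Summits.HodgeConjecture.HodgeConjecture.Theorems.R90S8ResGMidWildResidueOfLocallyBoundedContinuationU3   -- ★ p865346 (R90-CS-p03): `hW1_of_locallyBoundedContinuation` (J-S8-hW1′: `hW1` modulo the ONE letter (hLB))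
import HarnessLib

/-!
# R90-TF · S8 «ContSpec-n½» — `R90S8ResGMidBlockEqBotOfRecordV3U3`: (V♭)τ OF RECORD, ED. 3 — `¬ L(½, φ_ξ) ≠ 0 ⟹ resGMidBlockτ ξ μω = ⊥` modulo (R)′τ's head `hRes`, (R)′τ's `hEXP` row
# and (R)′τ's `hSCALrows` row (byte for byte) — ONE residual for (V♭)τ and (R)′τ

Cell `hodgecm-mathlib`, crux H413 (`stmt-HodgeConjecture-24833`, lane `--supports … --as helper`), route of record `HCCMUnconditional`; R90-TF section S8, socket (V♭)
`sock_S8_res_midBlock_eq_bot_of_not_LHalfNeZero` (B ED. 7 :406) on the τ-admissible block.  THEOREMS ONLY (no `def`, no `instance`, no `notation`, no named-fact hypothesis, no `sorry`;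
default heartbeats); count-neutral; CLOSES NO SOCKET (OF-RECORD composition).

WHY ED. 3 (this seat's census of S8-R296 (2); typ1's board «(V♭) follows (R)′τ + cores + hW1, no hand needed»).  ED. 2 (★ p865014) took the per-datum analytic input in its weakest form
`hSCALτ` (per `g`: an amplitude holomorphic on `{1<Re}` with the tube factorisation through the block's scalar).  (R)′τ (★ `res_midBlock_le_residual_of_tauAdmissible`) carries the same
content as its row `hSCALrows` (clauses 1 + 3), but over a LONGER binder list (the datum's pole letter and class `Fp hFp hFpE f hf`, and a ∀-quantified normalised package
`ν hν 𝓕 h𝓕N h𝓕c hνi hν1`) — so neither binder projects to the other for free.  ED. 3 simply TAKES `hSCALrows` in (R)′τ's bytes (with `cS :=` the explicit scalar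
`L^S(z−1, φ_ξ)ζ^T(2z−2)∕(L^S(z, φ_ξ)ζ^T(2z−1))` of ★ F4) and calls it inside the per-generator descent, where the D1τ datum supplies `Fp, f` and the head's own package `(ν₀, 𝓕₀)`
(inversion-invariant, `ν₀ 𝓕₀ = 1`) is fed to the row; the rest of the proof is ED. 2's verbatim (★ F4 + ★ p864870 §2: `G(3∕2) = 0`; `ψ := (CT − φH^z)∕H^{2−z}` holomorphic on the slit plane ★
from the `hEXP` row; §1 of ED. 2: zero residue of `ψ(·, g)`; ★ p864915 §1 with `hRes`: the class vanishes; minimality).  AFTER ED. 3: (V♭)τ OF RECORD = {`hRes` = (R)′τ's head, `hEXP` =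
(R)′τ's row ★ `hEXP_tauRow_closed'`, `hSCALrows` = (R)′τ's row} + F4's frame + `hφ1` — every letter of (V♭)τ IS a letter of (R)′τ.
* **`resGMidBlockτ_eq_bot_of_not_lHalfNeZero_of_record_v3`** (head), **`resGMidBlock_eq_bot_of_not_lHalfNeZero_of_record_v3`** (socket bytes: `hW1` BOUND to ★ p865346 `hW1_of_locallyBoundedContinuation (hμu) (hLB)` — J-S8-hW1′ —, (R)′τ's literal conclusion).
HONEST LABEL: HC_CM is proved only modulo the 7 printed citations (2 remaining named inputs: hLiu418 = `stmt-HodgeConjecture-24832`, h413 = `stmt-HodgeConjecture-24833`) until rung 0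
closes; REL ≠ ★ ≠ BUILT; this file asserts no named fact and closes no socket; count-neutral.

## References
* [MoeglinWaldspurger1995] C. Mœglin, J.-L. Waldspurger, *Spectral Decomposition and Eisenstein Series* (1995), IV.1.9–IV.1.11, V.3.13.
* [Langlands1976] R. P. Langlands, *On the Functional Equations Satisfied by Eisenstein Series*, LNM 544 (1976), §7.
* [Rogawski1990] J. D. Rogawski, *Automorphic Representations of Unitary Groups in Three Variables* (1990), §13.9 p. 229 (ii).
-/

set_option autoImplicit false
set_option linter.dupNamespace false  -- the mandated namespace `…HodgeConjecture.HodgeConjecture.R90.S8` (LEAD #1 L1) repeats the summit's segment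

noncomputable section

open MeasureTheory Measure Set Filter Topology NumberField IsDedekindDomain
open scoped ENNReal NNReal Topology
open Literature.NumberTheory.Automorphic Literature.NumberTheory.Automorphic.UnitaryGroup Literature.NumberTheory.GaloisRepresentations Literature.NumberTheory.LFunctions AdelicGroupData ContRepresentation
open Literature.NumberTheory.Automorphic.Arthur2013.Leaves.TECR Literature.NumberTheory.Rogawski1990
open Summit.HodgeConjecture.HodgeConjecture.Cruxes.H413.K2E1BorelEisensteinU
open Summit.HodgeConjecture.HodgeConjecture.Cruxes.H413.K2E1CharacterEisensteinU3PairDefs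
open Summit.HodgeConjecture.HodgeConjecture.Cruxes.H413.K2E1ChiSectionSpaceU3PairDefs
open Summit.HodgeConjecture.HodgeConjecture.Cruxes.H413.K2E1CuspidalSpectrumUnitary
open Summit.HodgeConjecture.HodgeConjecture.Cruxes.H413.K2E1HeckeLHalfNeZeroDefs (LHalfNeZero)
open Summit.HodgeConjecture.HodgeConjecture.Cruxes.H413.K2E1ChiIntertwiningScalarEulerQuotientU3CM (exists_differentiableOn_mul_chiScalar_cm_three)
open Summit.HodgeConjecture.HodgeConjecture.Cruxes.H413.K2E1ChiConstantTermHolomorphicCMThree (differentiableOn_middleCoefficient_slitPlane_cm_three)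
open Summit.HodgeConjecture.HodgeConjecture.Cruxes.H413.K2E1ConvexDiffCountableConnected (isPreconnected_convex_diff_of_countable)

namespace Summit.HodgeConjecture.HodgeConjecture.R90.S8

section Record

variable (L : Type) [Field L] [NumberField L] [IsCMField L]
  [MeasurableSpace (quasiSplit (↥(maximalRealSubfield L)) L (IsCMField.complexConj L) 3).Adelic] [BorelSpace (quasiSplit (↥(maximalRealSubfield L)) L (IsCMField.complexConj L) 3).Adelic]
  (μ : Measure (quasiSplit (↥(maximalRealSubfield L)) L (IsCMField.complexConj L) 3).automorphicQuotient)
  [(quasiSplit (↥(maximalRealSubfield L)) L (IsCMField.complexConj L) 3).IsAutomorphicMeasure μ]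
  (ξ : OneDimAutRepH L) (μω : HeckeCharacter L)

/-- **(V♭)τ OF RECORD, ED. 3 — `¬ LHalfNeZero (ξ.bcη⁻¹·μω) → resGMidBlockτ ξ μω = ⊥` modulo (R)′τ's head `hRes`, (R)′τ's `hEXP` row and (R)′τ's `hSCALrows` row (bytes).**
Frame: ★ F4's data for `φ_ξ := ξ.bcη⁻¹·μω`, the finite `T`, `hφ1 : φ_ξ ≠ 1`; a NORMALISED Heisenberg CT package `(ν₀, 𝓕₀)` (`ν₀` inversion-invariant, `ν₀ 𝓕₀ = 1`); a Borel parabolic datum `𝔓`.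
See the module docstring for the chain (ED. 2's proof with `hSCALrows` called per datum). [cite: MoeglinWaldspurger1995, IV.1.11, V.3.13] [cite: Langlands1976, §7] [cite: Rogawski1990, §13.9 p. 229 (ii)] -/
theorem resGMidBlockτ_eq_bot_of_not_lHalfNeZero_of_record_v3
    -- ★ F4's frame for `φ := ξ.bcη⁻¹·μω`, `η := 1`
    (hφu : (ξ.bcη⁻¹ * μω).IsUnitary) (hφA : ∀ t : ℝ≥0ˣ, (ξ.bcη⁻¹ * μω) (posRealIdele L t) = 1)
    {S : Set (HeightOneSpectrum (𝓞 L))} (hS : S.Finite) (hurφ : ∀ w ∉ S, (ξ.bcη⁻¹ * μω).IsUnramifiedAt w)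
    {T : Set (HeightOneSpectrum (𝓞 ↥(maximalRealSubfield L)))} (hT : T.Finite) (hurη : ∀ v ∉ T, (1 : HeckeCharacter ↥(maximalRealSubfield L)).IsUnramifiedAt v)
    (hφ1 : ξ.bcη⁻¹ * μω ≠ 1)
    -- the NORMALISED Heisenberg CT package (`ν₀` inversion-invariant, `ν₀ 𝓕₀ = 1`: the package at which (R)′τ's rows are called)
    (ν₀ : Measure ↥(adelicUnipotent (↥(maximalRealSubfield L)) L (IsCMField.complexConj L) 3)) [ν₀.IsHaarMeasure] [ν₀.IsInvInvariant]
    {𝓕₀ : Set ↥(adelicUnipotent (↥(maximalRealSubfield L)) L (IsCMField.complexConj L) 3)}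
    (h𝓕₀ : IsFundamentalDomain ↥(rationalUnipotent (↥(maximalRealSubfield L)) L (IsCMField.complexConj L) 3) 𝓕₀ ν₀) (h𝓕₀c : IsCompact (closure 𝓕₀))
    (h𝓕₀1 : ν₀ 𝓕₀ = 1)
    -- the Borel parabolic datum of `L²_res`
    (𝔓 : (quasiSplit (↥(maximalRealSubfield L)) L (IsCMField.complexConj L) 3).ParabolicUnipotentData)
    (h𝔓 : ∀ j : 𝔓.ι, 𝔓.radical j = adelicUnipotent (↥(maximalRealSubfield L)) L (IsCMField.complexConj L) 3)
    -- (R)′τ: the τ-admissible middle block is residual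
    (hRes : (resGMidBlockτ L μ ξ μω).toSubmodule ≤ (residualSubspace (quasiSplit (↥(maximalRealSubfield L)) L (IsCMField.complexConj L) 3) μ 𝔓).toSubmodule)
    -- (R)′τ's `hEXP` ROW: ESTATE T's (E4) + (E2-bd) for the datum's own `Ec` on the slit plane (★ `hEXP_tauRow_closed'`)
    (hEXP : ∀ (U₀ : Subgroup ↥(finAdelic (↥(maximalRealSubfield L)) L (IsCMField.complexConj L) 3 ((StdForm.antidiagonal 3).over L))) (_ : IsTauLevel L U₀)
      (φ : (quasiSplit (↥(maximalRealSubfield L)) L (IsCMField.complexConj L) 3).Adelic → ℂ) (_ : φ ∈ chiSectionSpacePair (ξ.bcη⁻¹ * ξ.bcψ⁻¹ * μω) ξ.ψ (tauLevel L U₀) ((1 : ↥(tauLevel L U₀) →* ℂ) : ↥(tauLevel L U₀) → ℂ)) (_ : Continuous φ)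
      (_ : IsArchFinite L φ)
      (Ec : ℂ → (quasiSplit (↥(maximalRealSubfield L)) L (IsCMField.complexConj L) 3).Adelic → ℂ) (Sp : Finset ℂ) (_ : ∀ s ∈ Sp, s.im = 0 ∧ 1 < s.re ∧ s.re ≤ 2)
      (_ : ∀ g, DifferentiableOn ℂ (fun z => Ec z g) ({z : ℂ | 1 < z.re} \ (↑Sp : Set ℂ)))
      (_ : ∀ z : ℂ, 2 < z.re → Ec z = eisensteinSeriesU (flatSectionU φ z))
      (Fp : (quasiSplit (↥(maximalRealSubfield L)) L (IsCMField.complexConj L) 3).Adelic → ℂ → ℂ) (_ : ∀ g, AnalyticAt ℂ (Fp g) ((3 : ℂ) / 2))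
      (_ : ∀ g, Fp g =ᶠ[𝓝[≠] ((3 : ℂ) / 2)] fun z => (z - (3 : ℂ) / 2) * Ec z g)
      (f : (quasiSplit (↥(maximalRealSubfield L)) L (IsCMField.complexConj L) 3).L2 μ) (_ : (f : (quasiSplit (↥(maximalRealSubfield L)) L (IsCMField.complexConj L) 3).automorphicQuotient → ℂ) =ᵐ[μ] fun x => Fp (Quotient.out (x : (quasiSplit (↥(maximalRealSubfield L)) L (IsCMField.complexConj L) 3).Adelic ⧸ (quasiSplit (↥(maximalRealSubfield L)) L (IsCMField.complexConj L) 3).quotientSubgroup))⁻¹ ((3 : ℂ) / 2)), (∀ z ∈ ({z : ℂ | 1 < z.re} \ (↑Sp : Set ℂ)), Continuous (Ec z)) ∧ (∀ z₁ ∈ ({z : ℂ | 1 < z.re} \ (↑Sp : Set ℂ)), ∀ K : Set (quasiSplit (↥(maximalRealSubfield L)) L (IsCMField.complexConj L) 3).Adelic, IsCompact K → ∃ V ∈ 𝓝 z₁, ∃ M : ℝ, ∀ z ∈ V, ∀ g ∈ K, ‖Ec z g‖ ≤ M))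
    -- (R)′τ's `hSCALrows` ROW, BYTE FOR BYTE (★ `res_midBlock_le_residual_of_tauAdmissible` :110–125) at `cS :=` the block's explicit scalar `L^S(z−1)ζ^T(2z−2)∕(L^S(z)ζ^T(2z−1))`
    (hSCALrows : ∀ (U₀ : Subgroup ↥(finAdelic (↥(maximalRealSubfield L)) L (IsCMField.complexConj L) 3 ((StdForm.antidiagonal 3).over L))) (_ : IsTauLevel L U₀)
      (φ : (quasiSplit (↥(maximalRealSubfield L)) L (IsCMField.complexConj L) 3).Adelic → ℂ) (_ : φ ∈ chiSectionSpacePair (ξ.bcη⁻¹ * ξ.bcψ⁻¹ * μω) ξ.ψ (tauLevel L U₀) ((1 : ↥(tauLevel L U₀) →* ℂ) : ↥(tauLevel L U₀) → ℂ)) (_ : Continuous φ)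
      (_ : IsArchFinite L φ)
      (Ec : ℂ → (quasiSplit (↥(maximalRealSubfield L)) L (IsCMField.complexConj L) 3).Adelic → ℂ) (Sp : Finset ℂ) (_ : ∀ s ∈ Sp, s.im = 0 ∧ 1 < s.re ∧ s.re ≤ 2)
      (_ : ∀ g, DifferentiableOn ℂ (fun z => Ec z g) ({z : ℂ | 1 < z.re} \ (↑Sp : Set ℂ)))
      (_ : ∀ z : ℂ, 2 < z.re → Ec z = eisensteinSeriesU (flatSectionU φ z))
      (Fp : (quasiSplit (↥(maximalRealSubfield L)) L (IsCMField.complexConj L) 3).Adelic → ℂ → ℂ) (_ : ∀ g, AnalyticAt ℂ (Fp g) ((3 : ℂ) / 2))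
      (_ : ∀ g, Fp g =ᶠ[𝓝[≠] ((3 : ℂ) / 2)] fun z => (z - (3 : ℂ) / 2) * Ec z g)
      (f : (quasiSplit (↥(maximalRealSubfield L)) L (IsCMField.complexConj L) 3).L2 μ) (_ : (f : (quasiSplit (↥(maximalRealSubfield L)) L (IsCMField.complexConj L) 3).automorphicQuotient → ℂ) =ᵐ[μ] fun x => Fp (Quotient.out (x : (quasiSplit (↥(maximalRealSubfield L)) L (IsCMField.complexConj L) 3).Adelic ⧸ (quasiSplit (↥(maximalRealSubfield L)) L (IsCMField.complexConj L) 3).quotientSubgroup))⁻¹ ((3 : ℂ) / 2))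
      (ν : Measure ↥(adelicUnipotent (↥(maximalRealSubfield L)) L (IsCMField.complexConj L) 3)) (_ : ν.IsHaarMeasure) (𝓕 : Set ↥(adelicUnipotent (↥(maximalRealSubfield L)) L (IsCMField.complexConj L) 3)) (_ : IsFundamentalDomain ↥(rationalUnipotent (↥(maximalRealSubfield L)) L (IsCMField.complexConj L) 3) 𝓕 ν) (_ : IsCompact (closure 𝓕)) (_ : ν.IsInvInvariant) (_ : ν 𝓕 = 1),
      ∃ (Ag : (quasiSplit (↥(maximalRealSubfield L)) L (IsCMField.complexConj L) 3).Adelic → ℂ → ℂ) (M : ℝ),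
        (∀ g, DifferentiableOn ℂ (Ag g) {z : ℂ | 1 < z.re}) ∧ (∀ g, ‖Ag g (3 / 2)‖ ≤ M) ∧
        (∀ z : ℂ, 2 < z.re → ∀ g : (quasiSplit (↥(maximalRealSubfield L)) L (IsCMField.complexConj L) 3).Adelic, (borelConstantTerm ν 𝓕 (Ec z) g - φ g * (((borelHeight g : ℝ≥0) : ℝ) : ℂ) ^ z) / (((borelHeight g : ℝ≥0) : ℝ) : ℂ) ^ (2 - z) = Ag g z *
          ((partialStandardL S (fun w => {(ξ.bcη⁻¹ * μω).valueAtUniformizer w}) (z - 1) * partialStandardL T (fun v => {(1 : HeckeCharacter ↥(maximalRealSubfield L)).valueAtUniformizer v}) (2 * z - 2)) /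
            (partialStandardL S (fun w => {(ξ.bcη⁻¹ * μω).valueAtUniformizer w}) z * partialStandardL T (fun v => {(1 : HeckeCharacter ↥(maximalRealSubfield L)).valueAtUniformizer v}) (2 * z - 1)))) ∧
        (Measurable fun g : (quasiSplit (↥(maximalRealSubfield L)) L (IsCMField.complexConj L) 3).Adelic => Ag g ((3 : ℂ) / 2)) ∧
        (∀ b ∈ arithmeticBorel (↥(maximalRealSubfield L)) L (IsCMField.complexConj L) 3, ∀ x : (quasiSplit (↥(maximalRealSubfield L)) L (IsCMField.complexConj L) 3).Adelic, Ag ((b : (quasiSplit (↥(maximalRealSubfield L)) L (IsCMField.complexConj L) 3).Adelic) * x) ((3 : ℂ) / 2) = Ag x ((3 : ℂ) / 2)) ∧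
        (∀ (u : ↥(adelicUnipotent (↥(maximalRealSubfield L)) L (IsCMField.complexConj L) 3)) (g : (quasiSplit (↥(maximalRealSubfield L)) L (IsCMField.complexConj L) 3).Adelic), Ag ((u : (quasiSplit (↥(maximalRealSubfield L)) L (IsCMField.complexConj L) 3).Adelic) * g) ((3 : ℂ) / 2) = Ag g ((3 : ℂ) / 2))) :
    ¬ LHalfNeZero (ξ.bcη⁻¹ * μω) → resGMidBlockτ L μ ξ μω = ⊥ := by
  intro hL
  have h𝓕₀0 : ν₀ 𝓕₀ ≠ 0 := by rw [h𝓕₀1]; exact one_ne_zero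
  have h𝓕₀top : ν₀ 𝓕₀ ≠ ∞ := by rw [h𝓕₀1]; exact ENNReal.one_ne_top
  -- ★ F4 for `(φ, η) := (ξ.bcη⁻¹·μω, 1)`: the scalar weight identity and `G(3∕2) = 0`
  obtain ⟨G, hG, hGeq, -, hG0, hG32⟩ := exists_differentiableOn_mul_chiScalar_cm_three L hφu hφA hS hurφ HeckeCharacter.isUnitary_one
    (fun t => by rw [HeckeCharacter.one_apply]) hT hurη
  have hG32' : G (3 / 2) = 0 := chiScalarG_three_halves_eq_zero_of_not_lHalfNeZero hG0 hG32 hφ1 hL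
  have hO : IsOpen {z : ℂ | 1 < z.re} := isOpen_lt continuous_const Complex.continuous_re
  have h32 : (3 : ℂ) / 2 ∈ {z : ℂ | 1 < z.re} := by
    rw [mem_setOf_eq, Complex.div_ofNat_re]
    norm_num
  refine le_bot_iff.1 (resGMidBlockτ_le L μ ξ μω ⊥ fun U₀ hU₀ => ?_)
  -- every τ-admissible generator class at the level `U₀` vanishes
  have hgen : resGMidAtomGenτ L μ ξ μω U₀ ⊆ {0} := by
    rintro f ⟨φ, hφ, hφc, hφa, Ec, Sp, hSp, hhol, hEis, Fp, hFp, hFpE, hf⟩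
    obtain ⟨hE4, hEbd⟩ := hEXP U₀ hU₀ φ hφ hφc hφa Ec Sp hSp hhol hEis Fp hFp hFpE f hf
    -- (R)′τ's scalar row at THIS datum and at the package `(ν₀, 𝓕₀)`: the amplitude `Ag` and the tube factorisation through the explicit scalar
    obtain ⟨Ag, -, hAg, -, hfacg, -⟩ := hSCALrows U₀ hU₀ φ hφ hφc hφa Ec Sp hSp hhol hEis Fp hFp hFpE f hf ν₀ inferInstance 𝓕₀ h𝓕₀ h𝓕₀c inferInstance h𝓕₀1
    -- the pole set `P* := ↑Sp ∪ {Re ≤ 1}` of the datum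
    have hDo : IsOpen ({z : ℂ | 1 < z.re} \ (↑Sp : Set ℂ)) := hO.sdiff Sp.finite_toSet.isClosed
    have hPiff : ∀ z : ℂ, z ∉ ((↑Sp : Set ℂ) ∪ {z : ℂ | z.re ≤ 1}) ↔ z ∈ ({z : ℂ | 1 < z.re} \ (↑Sp : Set ℂ)) := fun z => by
      simp only [mem_union, mem_setOf_eq, Set.mem_sdiff, not_or, not_le]
      exact and_comm
    have hPdisc : ∀ᶠ s in 𝓝[≠] ((3 : ℂ) / 2), s ∉ ((↑Sp : Set ℂ) ∪ {z : ℂ | z.re ≤ 1}) := by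
      filter_upwards [mem_nhdsWithin_of_mem_nhds (hO.mem_nhds h32), eventually_nhdsNE_not_mem_finset Sp _] with s hs hsS
      exact (hPiff s).2 ⟨hs, hsS⟩
    have hEcA : ∀ g (z : ℂ), z ∉ ((↑Sp : Set ℂ) ∪ {z : ℂ | z.re ≤ 1}) → AnalyticAt ℂ (fun z => Ec z g) z := fun g z hz =>
      (hhol g).analyticAt (hDo.mem_nhds ((hPiff z).1 hz))
    have hEcc : ∀ z : ℂ, z ∉ ((↑Sp : Set ℂ) ∪ {z : ℂ | z.re ≤ 1}) → Continuous (Ec z) := fun z hz => hE4 z ((hPiff z).1 hz)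
    have hE2bd : ∀ z₁ : ℂ, z₁ ∉ ((↑Sp : Set ℂ) ∪ {z : ℂ | z.re ≤ 1}) → ∀ K : Set (quasiSplit (↥(maximalRealSubfield L)) L (IsCMField.complexConj L) 3).Adelic, IsCompact K →
        ∃ V ∈ 𝓝 z₁, ∃ M : ℝ, ∀ z ∈ V, ∀ g ∈ K, ‖Ec z g‖ ≤ M := fun z₁ hz₁ K hK => hEbd z₁ ((hPiff z₁).1 hz₁) K hK
    -- the second CT coefficient `ψ`, DEFINED from the constant term; the ℓ-CT shape holds identically (`H(g) > 0`)
    have hH0 : ∀ g : (quasiSplit (↥(maximalRealSubfield L)) L (IsCMField.complexConj L) 3).Adelic, ∀ z : ℂ, (((borelHeight g : ℝ≥0) : ℝ) : ℂ) ^ z ≠ 0 := fun g z h =>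
      (Complex.ofReal_ne_zero.2 (NNReal.coe_pos.2 (borelHeight_pos g)).ne') ((Complex.cpow_eq_zero_iff _ _).1 h).1
    have hCT : ∀ᶠ z in 𝓝[≠] ((3 : ℂ) / 2), ∀ g : (quasiSplit (↥(maximalRealSubfield L)) L (IsCMField.complexConj L) 3).Adelic,
        borelConstantTerm ν₀ 𝓕₀ (Ec z) g = φ g * (((borelHeight g : ℝ≥0) : ℝ) : ℂ) ^ z +
          (fun (z : ℂ) (g : (quasiSplit (↥(maximalRealSubfield L)) L (IsCMField.complexConj L) 3).Adelic) =>
            (borelConstantTerm ν₀ 𝓕₀ (Ec z) g - φ g * (((borelHeight g : ℝ≥0) : ℝ) : ℂ) ^ z) / (((borelHeight g : ℝ≥0) : ℝ) : ℂ) ^ (2 - z)) z g * (((borelHeight g : ℝ≥0) : ℝ) : ℂ) ^ (2 - z) :=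
      Filter.Eventually.of_forall fun z g => by
        dsimp only
        rw [div_mul_cancel₀ _ (hH0 g (2 - z))]
        ring
    -- `ψ(·, g)` is holomorphic on the slit plane (★, from the `hEXP` row), so §1 gives its zero residue at `3∕2` for every `g`
    have hψhol := differentiableOn_middleCoefficient_slitPlane_cm_three L Ec Sp hhol hE4 hEbd ν₀ h𝓕₀ h𝓕₀c φ
      (fun (z : ℂ) (g : (quasiSplit (↥(maximalRealSubfield L)) L (IsCMField.complexConj L) 3).Adelic) =>
        (borelConstantTerm ν₀ 𝓕₀ (Ec z) g - φ g * (((borelHeight g : ℝ≥0) : ℝ) : ℂ) ^ z) / (((borelHeight g : ℝ≥0) : ℝ) : ℂ) ^ (2 - z)) fun _ _ _ => rfl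
    have hψ0 : ∀ g : (quasiSplit (↥(maximalRealSubfield L)) L (IsCMField.complexConj L) 3).Adelic,
        Tendsto (fun z : ℂ => (z - (3 : ℂ) / 2) *
          (fun (z : ℂ) (g : (quasiSplit (↥(maximalRealSubfield L)) L (IsCMField.complexConj L) 3).Adelic) =>
            (borelConstantTerm ν₀ 𝓕₀ (Ec z) g - φ g * (((borelHeight g : ℝ≥0) : ℝ) : ℂ) ^ z) / (((borelHeight g : ℝ≥0) : ℝ) : ℂ) ^ (2 - z)) z g) (𝓝[≠] ((3 : ℂ) / 2)) (𝓝 0) := fun g => by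
      exact tendsto_sub_three_halves_mul_of_slitFactorisation (fun s hs => (hSp s hs).2.2) (hψhol g) (hAg g) (fun z hz => hfacg z hz g) hG hGeq hG32'
    -- left invariance of the residue function; the class lies in `L²_res(𝔓)` ((R)′τ); ★ p864915 §1
    have hinv := midPoleLetter_apply_quotientSubgroup_mul L (isChiSectionPair_of_mem hφ) ξ.hψ (fun s hs => (hSp s hs).1) hhol hEis
      (z₀ := (3 : ℂ) / 2) (by norm_num) (by norm_num) hFp hFpE
    have hfres : f ∈ (residualSubspace (quasiSplit (↥(maximalRealSubfield L)) L (IsCMField.complexConj L) 3) μ 𝔓).toSubmodule :=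
      hRes (resGMidAtomτ_le_resGMidBlockτ L μ ξ μω hU₀ (subset_resGMidAtomτ L μ ξ μω U₀ ⟨φ, hφ, hφc, hφa, Ec, Sp, hSp, hhol, hEis, Fp, hFp, hFpE, hf⟩))
    exact Set.mem_singleton_iff.2
      (res_class_eq_zero_of_zero_coeff_residue L μ ν₀ h𝓕₀ h𝓕₀c h𝓕₀0 h𝓕₀top Ec _ hPdisc hEcA hEcc hE2bd Fp hFp hFpE hinv φ _ hCT hψ0 𝔓 h𝔓 hf hfres)
  have hspan : Submodule.span ℂ (resGMidAtomGenτ L μ ξ μω U₀) = ⊥ :=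
    Submodule.span_eq_bot.2 fun f hf => Set.mem_singleton_iff.1 (hgen hf)
  have hcl : IsClosed ((⊥ : Submodule ℂ ((quasiSplit (↥(maximalRealSubfield L)) L (IsCMField.complexConj L) 3).L2 μ)) : Set ((quasiSplit (↥(maximalRealSubfield L)) L (IsCMField.complexConj L) 3).L2 μ)) := by
    rw [Submodule.bot_coe]; exact isClosed_singleton
  rw [resGMidAtomτ_def, hspan, hcl.submodule_topologicalClosure_eq, ClosedSubrep.toSubmodule_bot]


/-- **(V♭) OF RECORD, ED. 3 — THE SOCKET BYTES `¬ LHalfNeZero (ξ.bcη⁻¹ * μω) → resGMidBlock L μ ξ μω = ⊥`** with `hW1` BOUND BY NAME (★ p865346 `hW1_of_locallyBoundedContinuation hμu hLB`,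
J-S8-hW1′ — visible: `μω` unitary and the letter (hLB)) and (R)′τ's LITERAL conclusion
`hR : resGMidBlock ξ μω ≤ L²_res(𝔓)` (★ `res_midBlock_le_residual_of_tauAdmissible`), with (R)′τ's `hEXP` and `hSCALrows` rows. [cite: MoeglinWaldspurger1995, IV.1.11, V.3.13] [cite: Rogawski1990, §13.9 p. 229 (ii)] -/
theorem resGMidBlock_eq_bot_of_not_lHalfNeZero_of_record_v3
    -- J-S8-hW1′: `hW1 := hW1_of_locallyBoundedContinuation L μ ξ hμu hLB` (★ p865346) — `μω` unitary and the ONE letter (hLB)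
    (hμu : μω.IsUnitary)
    (hLB : ∀ (φ : (quasiSplit (↥(maximalRealSubfield L)) L (IsCMField.complexConj L) 3).Adelic → ℂ)
      (_ : φ ∈ chiSectionSpacePair (ξ.bcη⁻¹ * ξ.bcψ⁻¹ * μω) ξ.ψ (⊥ : Subgroup (quasiSplit (↥(maximalRealSubfield L)) L (IsCMField.complexConj L) 3).Adelic)
        ((1 : ↥(⊥ : Subgroup (quasiSplit (↥(maximalRealSubfield L)) L (IsCMField.complexConj L) 3).Adelic) →* ℂ) :
          ↥(⊥ : Subgroup (quasiSplit (↥(maximalRealSubfield L)) L (IsCMField.complexConj L) 3).Adelic) → ℂ)) (_ : Continuous φ)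
      (Ec : ℂ → (quasiSplit (↥(maximalRealSubfield L)) L (IsCMField.complexConj L) 3).Adelic → ℂ) (Sp : Finset ℂ)
      (_ : ∀ s ∈ Sp, s.im = 0 ∧ 1 < s.re ∧ s.re ≤ 2)
      (_ : ∀ g, DifferentiableOn ℂ (fun z => Ec z g) ({z : ℂ | 1 < z.re} \ (↑Sp : Set ℂ)))
      (_ : ∀ z : ℂ, 2 < z.re → Ec z = eisensteinSeriesU (flatSectionU φ z)),
      ∀ z₁ ∈ ({z : ℂ | 1 < z.re} \ (↑Sp : Set ℂ)), ∀ S : Set (quasiSplit (↥(maximalRealSubfield L)) L (IsCMField.complexConj L) 3).Adelic, IsCompact S →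
        ∃ V ∈ 𝓝 z₁, ∃ M : ℝ, ∀ z ∈ V, ∀ g ∈ S, ‖Ec z g‖ ≤ M)
    -- ★ F4's frame for `φ := ξ.bcη⁻¹·μω`, `η := 1`
    (hφu : (ξ.bcη⁻¹ * μω).IsUnitary) (hφA : ∀ t : ℝ≥0ˣ, (ξ.bcη⁻¹ * μω) (posRealIdele L t) = 1)
    {S : Set (HeightOneSpectrum (𝓞 L))} (hS : S.Finite) (hurφ : ∀ w ∉ S, (ξ.bcη⁻¹ * μω).IsUnramifiedAt w)
    {T : Set (HeightOneSpectrum (𝓞 ↥(maximalRealSubfield L)))} (hT : T.Finite) (hurη : ∀ v ∉ T, (1 : HeckeCharacter ↥(maximalRealSubfield L)).IsUnramifiedAt v)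
    (hφ1 : ξ.bcη⁻¹ * μω ≠ 1)
    -- the NORMALISED Heisenberg CT package (`ν₀` inversion-invariant, `ν₀ 𝓕₀ = 1`: the package at which (R)′τ's rows are called)
    (ν₀ : Measure ↥(adelicUnipotent (↥(maximalRealSubfield L)) L (IsCMField.complexConj L) 3)) [ν₀.IsHaarMeasure] [ν₀.IsInvInvariant]
    {𝓕₀ : Set ↥(adelicUnipotent (↥(maximalRealSubfield L)) L (IsCMField.complexConj L) 3)}
    (h𝓕₀ : IsFundamentalDomain ↥(rationalUnipotent (↥(maximalRealSubfield L)) L (IsCMField.complexConj L) 3) 𝓕₀ ν₀) (h𝓕₀c : IsCompact (closure 𝓕₀))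
    (h𝓕₀1 : ν₀ 𝓕₀ = 1)
    -- the Borel parabolic datum of `L²_res`
    (𝔓 : (quasiSplit (↥(maximalRealSubfield L)) L (IsCMField.complexConj L) 3).ParabolicUnipotentData)
    (h𝔓 : ∀ j : 𝔓.ι, 𝔓.radical j = adelicUnipotent (↥(maximalRealSubfield L)) L (IsCMField.complexConj L) 3)
    -- (R)′τ's literal conclusion
    (hR : resGMidBlock L μ ξ μω ≤ residualSubspace (quasiSplit (↥(maximalRealSubfield L)) L (IsCMField.complexConj L) 3) μ 𝔓)
    -- (R)′τ's `hEXP` ROW: ESTATE T's (E4) + (E2-bd) for the datum's own `Ec` on the slit plane (★ `hEXP_tauRow_closed'`)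
    (hEXP : ∀ (U₀ : Subgroup ↥(finAdelic (↥(maximalRealSubfield L)) L (IsCMField.complexConj L) 3 ((StdForm.antidiagonal 3).over L))) (_ : IsTauLevel L U₀)
      (φ : (quasiSplit (↥(maximalRealSubfield L)) L (IsCMField.complexConj L) 3).Adelic → ℂ) (_ : φ ∈ chiSectionSpacePair (ξ.bcη⁻¹ * ξ.bcψ⁻¹ * μω) ξ.ψ (tauLevel L U₀) ((1 : ↥(tauLevel L U₀) →* ℂ) : ↥(tauLevel L U₀) → ℂ)) (_ : Continuous φ)
      (_ : IsArchFinite L φ)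
      (Ec : ℂ → (quasiSplit (↥(maximalRealSubfield L)) L (IsCMField.complexConj L) 3).Adelic → ℂ) (Sp : Finset ℂ) (_ : ∀ s ∈ Sp, s.im = 0 ∧ 1 < s.re ∧ s.re ≤ 2)
      (_ : ∀ g, DifferentiableOn ℂ (fun z => Ec z g) ({z : ℂ | 1 < z.re} \ (↑Sp : Set ℂ)))
      (_ : ∀ z : ℂ, 2 < z.re → Ec z = eisensteinSeriesU (flatSectionU φ z))
      (Fp : (quasiSplit (↥(maximalRealSubfield L)) L (IsCMField.complexConj L) 3).Adelic → ℂ → ℂ) (_ : ∀ g, AnalyticAt ℂ (Fp g) ((3 : ℂ) / 2))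
      (_ : ∀ g, Fp g =ᶠ[𝓝[≠] ((3 : ℂ) / 2)] fun z => (z - (3 : ℂ) / 2) * Ec z g)
      (f : (quasiSplit (↥(maximalRealSubfield L)) L (IsCMField.complexConj L) 3).L2 μ) (_ : (f : (quasiSplit (↥(maximalRealSubfield L)) L (IsCMField.complexConj L) 3).automorphicQuotient → ℂ) =ᵐ[μ] fun x => Fp (Quotient.out (x : (quasiSplit (↥(maximalRealSubfield L)) L (IsCMField.complexConj L) 3).Adelic ⧸ (quasiSplit (↥(maximalRealSubfield L)) L (IsCMField.complexConj L) 3).quotientSubgroup))⁻¹ ((3 : ℂ) / 2)), (∀ z ∈ ({z : ℂ | 1 < z.re} \ (↑Sp : Set ℂ)), Continuous (Ec z)) ∧ (∀ z₁ ∈ ({z : ℂ | 1 < z.re} \ (↑Sp : Set ℂ)), ∀ K : Set (quasiSplit (↥(maximalRealSubfield L)) L (IsCMField.complexConj L) 3).Adelic, IsCompact K → ∃ V ∈ 𝓝 z₁, ∃ M : ℝ, ∀ z ∈ V, ∀ g ∈ K, ‖Ec z g‖ ≤ M))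
    -- (R)′τ's `hSCALrows` ROW, BYTE FOR BYTE (★ `res_midBlock_le_residual_of_tauAdmissible` :110–125) at `cS :=` the block's explicit scalar `L^S(z−1)ζ^T(2z−2)∕(L^S(z)ζ^T(2z−1))`
    (hSCALrows : ∀ (U₀ : Subgroup ↥(finAdelic (↥(maximalRealSubfield L)) L (IsCMField.complexConj L) 3 ((StdForm.antidiagonal 3).over L))) (_ : IsTauLevel L U₀)
      (φ : (quasiSplit (↥(maximalRealSubfield L)) L (IsCMField.complexConj L) 3).Adelic → ℂ) (_ : φ ∈ chiSectionSpacePair (ξ.bcη⁻¹ * ξ.bcψ⁻¹ * μω) ξ.ψ (tauLevel L U₀) ((1 : ↥(tauLevel L U₀) →* ℂ) : ↥(tauLevel L U₀) → ℂ)) (_ : Continuous φ)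
      (_ : IsArchFinite L φ)
      (Ec : ℂ → (quasiSplit (↥(maximalRealSubfield L)) L (IsCMField.complexConj L) 3).Adelic → ℂ) (Sp : Finset ℂ) (_ : ∀ s ∈ Sp, s.im = 0 ∧ 1 < s.re ∧ s.re ≤ 2)
      (_ : ∀ g, DifferentiableOn ℂ (fun z => Ec z g) ({z : ℂ | 1 < z.re} \ (↑Sp : Set ℂ)))
      (_ : ∀ z : ℂ, 2 < z.re → Ec z = eisensteinSeriesU (flatSectionU φ z))
      (Fp : (quasiSplit (↥(maximalRealSubfield L)) L (IsCMField.complexConj L) 3).Adelic → ℂ → ℂ) (_ : ∀ g, AnalyticAt ℂ (Fp g) ((3 : ℂ) / 2))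
      (_ : ∀ g, Fp g =ᶠ[𝓝[≠] ((3 : ℂ) / 2)] fun z => (z - (3 : ℂ) / 2) * Ec z g)
      (f : (quasiSplit (↥(maximalRealSubfield L)) L (IsCMField.complexConj L) 3).L2 μ) (_ : (f : (quasiSplit (↥(maximalRealSubfield L)) L (IsCMField.complexConj L) 3).automorphicQuotient → ℂ) =ᵐ[μ] fun x => Fp (Quotient.out (x : (quasiSplit (↥(maximalRealSubfield L)) L (IsCMField.complexConj L) 3).Adelic ⧸ (quasiSplit (↥(maximalRealSubfield L)) L (IsCMField.complexConj L) 3).quotientSubgroup))⁻¹ ((3 : ℂ) / 2))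
      (ν : Measure ↥(adelicUnipotent (↥(maximalRealSubfield L)) L (IsCMField.complexConj L) 3)) (_ : ν.IsHaarMeasure) (𝓕 : Set ↥(adelicUnipotent (↥(maximalRealSubfield L)) L (IsCMField.complexConj L) 3)) (_ : IsFundamentalDomain ↥(rationalUnipotent (↥(maximalRealSubfield L)) L (IsCMField.complexConj L) 3) 𝓕 ν) (_ : IsCompact (closure 𝓕)) (_ : ν.IsInvInvariant) (_ : ν 𝓕 = 1),
      ∃ (Ag : (quasiSplit (↥(maximalRealSubfield L)) L (IsCMField.complexConj L) 3).Adelic → ℂ → ℂ) (M : ℝ),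
        (∀ g, DifferentiableOn ℂ (Ag g) {z : ℂ | 1 < z.re}) ∧ (∀ g, ‖Ag g (3 / 2)‖ ≤ M) ∧
        (∀ z : ℂ, 2 < z.re → ∀ g : (quasiSplit (↥(maximalRealSubfield L)) L (IsCMField.complexConj L) 3).Adelic, (borelConstantTerm ν 𝓕 (Ec z) g - φ g * (((borelHeight g : ℝ≥0) : ℝ) : ℂ) ^ z) / (((borelHeight g : ℝ≥0) : ℝ) : ℂ) ^ (2 - z) = Ag g z *
          ((partialStandardL S (fun w => {(ξ.bcη⁻¹ * μω).valueAtUniformizer w}) (z - 1) * partialStandardL T (fun v => {(1 : HeckeCharacter ↥(maximalRealSubfield L)).valueAtUniformizer v}) (2 * z - 2)) /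
            (partialStandardL S (fun w => {(ξ.bcη⁻¹ * μω).valueAtUniformizer w}) z * partialStandardL T (fun v => {(1 : HeckeCharacter ↥(maximalRealSubfield L)).valueAtUniformizer v}) (2 * z - 1)))) ∧
        (Measurable fun g : (quasiSplit (↥(maximalRealSubfield L)) L (IsCMField.complexConj L) 3).Adelic => Ag g ((3 : ℂ) / 2)) ∧
        (∀ b ∈ arithmeticBorel (↥(maximalRealSubfield L)) L (IsCMField.complexConj L) 3, ∀ x : (quasiSplit (↥(maximalRealSubfield L)) L (IsCMField.complexConj L) 3).Adelic, Ag ((b : (quasiSplit (↥(maximalRealSubfield L)) L (IsCMField.complexConj L) 3).Adelic) * x) ((3 : ℂ) / 2) = Ag x ((3 : ℂ) / 2)) ∧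
        (∀ (u : ↥(adelicUnipotent (↥(maximalRealSubfield L)) L (IsCMField.complexConj L) 3)) (g : (quasiSplit (↥(maximalRealSubfield L)) L (IsCMField.complexConj L) 3).Adelic), Ag ((u : (quasiSplit (↥(maximalRealSubfield L)) L (IsCMField.complexConj L) 3).Adelic) * g) ((3 : ℂ) / 2) = Ag g ((3 : ℂ) / 2))) :
    ¬ LHalfNeZero (ξ.bcη⁻¹ * μω) → resGMidBlock L μ ξ μω = ⊥ := fun hL =>
  le_bot_iff.1 ((hW1_of_locallyBoundedContinuation L μ ξ hμu hLB).trans (le_of_eq (resGMidBlockτ_eq_bot_of_not_lHalfNeZero_of_record_v3 L μ ξ μω hφu hφA hS hurφ hT hurη hφ1 ν₀ h𝓕₀ h𝓕₀c h𝓕₀1 𝔓 h𝔓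
    ((toSubmodule_resGMidBlockτ_le L μ ξ μω).trans (ClosedSubrep.toSubmodule_le_iff.2 hR)) hEXP hSCALrows hL)))

end Record

end Summit.HodgeConjecture.HodgeConjecture.R90.S8

end
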